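import Summits.RiemannHypothesis.RiemannHypothesis.Theorems.GroundBartaEvenWinsBeyondArchDeflationArchPanelsY
import Summits.RiemannHypothesis.RiemannHypothesis.Theorems.GroundBartaEvenWinsBeyondArchDeflationForms
import HarnessLib

/-!
# RiemannHypothesis / GroundBarta — rung 4 (`EvenWinsBeyondArch`, stmt-RiemannHypothesis-18807 / 18085):
# the deflated Temple L-side, A-layer VII — Gram entries and polarisation for scaled window polynomials

Helper file (`--supports`), RH-free, no named facts.  Prover A, speedrun unit `sr-gb-rung-a` (gen 2).

For the windowed penalty polynomials `v_P(x) = 𝟙_{[-b,b]}(x) P(x/b)` of the sigma bridge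
(`dt_weilOddGroundEnergy_ge_of_deflCert_sigma`, prover B):
* `dt_wY_add` — `v_P + v_Q = v_{P+Q}` (so pair energies are energies of the window polynomial `P + Q`);
* `dt_wY_memLp`, `dt_wY_off` — the `L²` / support hypotheses of the polarisation lemmas;
* `dt_inner_wY` — the exact Gram entry `∫ Re(v_P v̄_Q) = b · integPolyQ P Q 1`;
* `dt_A_offdiag`, `dt_A_diag` — `P₂(v_P,v_Q) + 𝓔₂(v_P,v_Q) = ½(T(P+Q) − T(P) − T(Q))`, `T(P) := P(v_P) + 𝓔_c(v_P)`
  (`dt_weilPoleForm_add`, `dt_weilDirichletEnergy_add`, prover B), and the diagonal case;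
* `dt_T_bounds` — `T` from the three A-layer certificates (pole `…PoleY`, primes `…PrimeY`, arch `…ArchPanelsY`).

References: F. Goerisch, H. Haunhorst, ZAMM 65 (1985) 129–135 [GoerischHaunhorst1985] (the matrix being assembled).
-/

set_option linter.dupNamespace false

noncomputable section

open MeasureTheory Set
open scoped BigOperators ComplexConjugate

namespace Summit.RiemannHypothesis.RiemannHypothesis.Theorems.EvenWinsBeyondArch

open Literature.NumberTheory.LFunctions Literature.Analysis.ValidatedNumerics.ExpPoly
open Literature.Analysis.ValidatedNumerics.PolyMP
open Summit.RiemannHypothesis.RiemannHypothesis.Theorems.OddSector (weilDirichletEnergy₂ weilPoleForm₂ weilPoleForm₂_self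
  weilDirichletEnergy₂_self)
open Summit.RiemannHypothesis.RiemannHypothesis.Theorems.GroundStateSimpleEven (incs_memLp)

/-- The windowed scaled polynomial `v_P(x) = 𝟙_{[-b,b]}(x) P(x/b)` as a complex test function. [folklore] -/
def dt_wY (P : Poly) (b : ℚ) : ℝ → ℂ := fun x ↦ (((Icc (-(b : ℝ)) b).indicator (fun x ↦ Poly.eval P (x / b)) x : ℝ) : ℂ)

/-- [folklore] -/
theorem dt_wY_apply (P : Poly) (b : ℚ) (x : ℝ) :
    dt_wY P b x = (((Icc (-(b : ℝ)) b).indicator (fun x ↦ Poly.eval P (x / b)) x : ℝ) : ℂ) := rfl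

/-- `v_P + v_Q = v_{P+Q}`. [folklore] -/
theorem dt_wY_add (P Q : Poly) (b : ℚ) : dt_wY P b + dt_wY Q b = dt_wY (Poly.add P Q) b := by
  funext x
  simp only [Pi.add_apply, dt_wY_apply]
  by_cases hx : x ∈ Icc (-(b : ℝ)) b
  · rw [indicator_of_mem hx, indicator_of_mem hx, indicator_of_mem hx, Poly.eval_add]; push_cast; ring
  · rw [indicator_of_notMem hx, indicator_of_notMem hx, indicator_of_notMem hx]; push_cast; ring

/-- `v_P ∈ L²`. [folklore] -/
theorem dt_wY_memLp (P : Poly) (b : ℚ) : MemLp (dt_wY P b) 2 volume :=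
  incs_memLp ((Poly.continuous_eval P).comp (continuous_id.div_const _)) (b : ℝ)

/-- `v_P` vanishes off the window. [folklore] -/
theorem dt_wY_off (P : Poly) (b : ℚ) : ∀ x, x ∉ Icc (-(b : ℝ)) b → dt_wY P b x = 0 := by
  intro x hx
  rw [dt_wY_apply, indicator_of_notMem hx]; simp

/-- **The Gram entry**: `∫ Re(v_P v̄_Q) = b · ∫_{-1}^{1} P Q = b · integPolyQ P Q 1`. [folklore] -/
theorem dt_inner_wY (P Q : Poly) {b : ℚ} (hb : 0 < b) :
    ∫ x, (dt_wY P b x * conj (dt_wY Q b x)).re = (b : ℝ) * ((integPolyQ P Q 1 : ℚ) : ℝ) := by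
  have hb' : (b : ℝ) ≠ 0 := by exact_mod_cast hb.ne'
  have e : (fun x ↦ (dt_wY P b x * conj (dt_wY Q b x)).re) =
      (Icc (-(b : ℝ)) b).indicator (fun x ↦ Poly.eval P (x / b) * Poly.eval Q (x / b)) := by
    funext x
    simp only [dt_wY_apply]
    by_cases hx : x ∈ Icc (-(b : ℝ)) b
    · rw [indicator_of_mem hx, indicator_of_mem hx, indicator_of_mem hx, Complex.conj_ofReal, ← Complex.ofReal_mul,
        Complex.ofReal_re]
    · rw [indicator_of_notMem hx, indicator_of_notMem hx, indicator_of_notMem hx]; simp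
  rw [e, MeasureTheory.integral_indicator measurableSet_Icc, integral_Icc_eq_integral_Ioc,
    ← intervalIntegral.integral_of_le (by linarith [(by exact_mod_cast hb : (0 : ℝ) < b)]),
    intervalIntegral.integral_comp_div (fun y ↦ Poly.eval P y * Poly.eval Q y) hb', neg_div, div_self hb', smul_eq_mul]
  have h1 := integral_eval_mul_eval P Q 1
  push_cast at h1
  rw [h1]

/-- **Polarisation**: `P₂(v_P, v_Q) + 𝓔₂(v_P, v_Q) = ½ (T(P+Q) − T(P) − T(Q))`, `T(P) = P(v_P) + 𝓔_c(v_P)`, given finite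
archimedean energies. [cite: GoerischHaunhorst1985, §2] -/
theorem dt_A_offdiag (P Q : Poly) (b : ℚ) (c : ℝ)
    (hEP : IntegrableOn (fun t ↦ weilArchDensity t * weilIncrement (dt_wY P b) t) (Ioi 0))
    (hEQ : IntegrableOn (fun t ↦ weilArchDensity t * weilIncrement (dt_wY Q b) t) (Ioi 0)) :
    weilPoleForm₂ (dt_wY P b) (dt_wY Q b) + weilDirichletEnergy₂ c (dt_wY P b) (dt_wY Q b) =
      ((weilPoleForm (dt_wY (Poly.add P Q) b) + weilDirichletEnergy c (dt_wY (Poly.add P Q) b)) -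
          (weilPoleForm (dt_wY P b) + weilDirichletEnergy c (dt_wY P b)) -
          (weilPoleForm (dt_wY Q b) + weilDirichletEnergy c (dt_wY Q b))) / 2 := by
  have hp := dt_weilPoleForm_add (a := (b : ℝ)) (dt_wY_memLp P b) (dt_wY_memLp Q b) (dt_wY_off P b) (dt_wY_off Q b)
  have hd := dt_weilDirichletEnergy_add c (dt_wY_memLp P b) (dt_wY_memLp Q b) hEP hEQ
  rw [dt_wY_add] at hp hd
  rw [hp, hd]; ring

/-- The diagonal case: `P₂(v,v) + 𝓔₂(v,v) = T(P)`. [folklore] -/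
theorem dt_A_diag (P : Poly) (b : ℚ) (c : ℝ) :
    weilPoleForm₂ (dt_wY P b) (dt_wY P b) + weilDirichletEnergy₂ c (dt_wY P b) (dt_wY P b) =
      weilPoleForm (dt_wY P b) + weilDirichletEnergy c (dt_wY P b) := by
  rw [weilPoleForm₂_self, weilDirichletEnergy₂_self]

/-- **`T(P)` from the three certificates**: pole form, prime increments and archimedean energy enclosures. [folklore] -/
theorem dt_T_bounds (P : Poly) (b : ℚ) (c : ℝ) (hcb : c = (b : ℝ)) {plo phi qlo qhi alo ahi : ℝ}
    (hpole : plo ≤ weilPoleForm (dt_wY P b) ∧ weilPoleForm (dt_wY P b) ≤ phi)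
    (hprime : qlo ≤ ∑ n ∈ weilPrimeIndex (b : ℝ), (ArithmeticFunction.vonMangoldt n : ℝ) / Real.sqrt n *
          weilIncrement (dt_wY P b) (Real.log n) ∧
      ∑ n ∈ weilPrimeIndex (b : ℝ), (ArithmeticFunction.vonMangoldt n : ℝ) / Real.sqrt n *
          weilIncrement (dt_wY P b) (Real.log n) ≤ qhi)
    (harch : alo ≤ ∫ t in Ioi 0, weilArchDensity t * weilIncrement (dt_wY P b) t ∧
      ∫ t in Ioi 0, weilArchDensity t * weilIncrement (dt_wY P b) t ≤ ahi) :
    plo + qlo + alo ≤ weilPoleForm (dt_wY P b) + weilDirichletEnergy c (dt_wY P b) ∧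
      weilPoleForm (dt_wY P b) + weilDirichletEnergy c (dt_wY P b) ≤ phi + qhi + ahi := by
  subst hcb
  unfold weilDirichletEnergy
  constructor <;> linarith [hpole.1, hpole.2, hprime.1, hprime.2, harch.1, harch.2]

end Summit.RiemannHypothesis.RiemannHypothesis.Theorems.EvenWinsBeyondArch

end
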